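import Mathlib
import Summits.KontsevichZagierPeriods.KontsevichZagierPeriods.Theorems.SoloInformedFormalPeriodModel
import HarnessLib
import HarnessLib.Audit

/-!
# SoloInformed — the formal period RING of `𝒞_G`, its evaluation map, change of degrees

Continuation of `SoloInformedFormalPeriodModel.lean` (engine of Proposition VI).  For an additive
commutative monoid `G` of degrees, the category `𝒞_G` of `G`-graded finite sets / graded
`ℚ`-matrices is a tensor category (`tensor`: product of bases, sum of degrees; unit `line 0`),
and [HW22, Rem. 7.7; Hub20, §3] the space of formal periods `P̃(𝒞_G)` becomes a commutative
`ℚ`-algebra with `⟦(X, σ, ω)⟧ · ⟦(Y, τ, η)⟧ = ⟦(X ⊗ Y, σ ⊗ τ, ω ⊗ η)⟧`.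

Results (all KERNEL):
* `instCommRing`, `cls_mul_cls` — the ring structure (transported through
  `fpEquiv : P̃(𝒞_G) ≃ ℚ[G]` and CERTIFIED to be the tensor product of symbols), `fpRingEquiv :
  P̃(𝒞_G) ≃+* ℚ[G]`, `gen_add : p_{g+g'} = p_g p_{g'}`, `gen_zero_eq_one : p_0 = 1`;
* the evaluation map of [HW22, Def. 7.11] for the fibre functor with comparison
  `φ_X = diag(c^{w(deg b)})` (`w : G →+ ℤ`, `c ∈ ℂˣ`): `evRingHom w c : P̃(𝒞_G) →+* ℂ` with
  `ev ⟦(X, σ, ω)⟧ = ω(φ_X σ) = ∑_b ω_b c^{w(deg b)} σ_b` (`ev_cls`), `ev p_g = c^{w g}` (`ev_gen`)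
  — so the Period Conjecture [HW22, Def. 7.15] for `(𝒞_G, w, c)` reads: `ℚ[G] → ℂ`,
  `[g] ↦ c^{w g}` is injective;
* change of degrees along `h : G →+ G'`: the tensor functor `h_* : 𝒞_G → 𝒞_{G'}`,
  `X ↦ (X.B, h ∘ deg)` (`mapObj`, `mapHom`; faithful: `mapHom_injective`), compatible with the
  fibre functors when `w = w' ∘ h`; the induced ring map of formal periods `fpMap h` IS the map on
  symbols (`fpMap_cls : ⟦(X, σ, ω)⟧ ↦ ⟦(h_* X, σ, ω)⟧`), equals `ℚ[h]` (`fpEquiv_fpMap`), and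
  intertwines the evaluations (`ev_fpMap`).

References: A. Huber, G. Wüstholz, *Transcendence and linear relations of 1-periods*, Cambridge
Tracts in Math. 227 (2022), Def. 7.6, Rem. 7.7, Def. 7.11, Def. 7.15; A. Huber, *Galois theory
of periods*, Münster J. Math. 13 (2020), §3.
-/

noncomputable section

open scoped BigOperators

namespace Summit.KontsevichZagierPeriods.KontsevichZagierPeriods.Theorems

namespace SoloInformedGrObj

variable {G : Type} [AddCommMonoid G]

open AddMonoidAlgebra

/-! ### The ring structure induced by `⊗` -/

/-- Multiplication on `P̃(𝒞_G)`, transported from `ℚ[G]`; it IS the tensor product of symbols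
by `cls_mul_cls` below. -/
instance instMul : Mul (FP G) := ⟨fun a b => fpEquiv.symm (fpEquiv a * fpEquiv b)⟩

/-- The unit, transported from `ℚ[G]`; it is `p_0 = ⟦(𝟙, 1, 1)⟧` by `gen_zero_eq_one`. -/
instance instOne : One (FP G) := ⟨fpEquiv.symm 1⟩

/-- Unfolding of the multiplication. -/
theorem mul_def' (a b : FP G) : a * b = fpEquiv.symm (fpEquiv a * fpEquiv b) := rfl

/-- Unfolding of the unit. -/
theorem one_def' : (1 : FP G) = fpEquiv.symm 1 := rfl

/-- `fpEquiv` is multiplicative. -/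
@[simp] theorem fpEquiv_mul (a b : FP G) : fpEquiv (a * b) = fpEquiv a * fpEquiv b := by
  rw [mul_def', LinearEquiv.apply_symm_apply]

/-- `fpEquiv 1 = 1`. -/
@[simp] theorem fpEquiv_one : fpEquiv (1 : FP G) = 1 := by
  rw [one_def', LinearEquiv.apply_symm_apply]

/-- `P̃(𝒞_G)` is a commutative ring [HW22, Rem. 7.7]. -/
instance instCommRing : CommRing (FP G) :=
  { (inferInstance : AddCommGroup (FP G)) with
    mul := (· * ·)
    one := 1
    mul_assoc := fun a b c => fpEquiv.injective (by simp [mul_assoc])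
    one_mul := fun a => fpEquiv.injective (by simp)
    mul_one := fun a => fpEquiv.injective (by simp)
    left_distrib := fun a b c => fpEquiv.injective (by simp [mul_add])
    right_distrib := fun a b c => fpEquiv.injective (by simp [add_mul])
    mul_comm := fun a b => fpEquiv.injective (by simp [mul_comm])
    zero_mul := fun a => fpEquiv.injective (by simp)
    mul_zero := fun a => fpEquiv.injective (by simp) }

/-- `P̃(𝒞_G) ≃+* ℚ[G]` as rings. -/
def fpRingEquiv : FP G ≃+* AddMonoidAlgebra ℚ G :=
  { fpEquiv (G := G) with
    map_mul' := fpEquiv_mul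
    map_add' := fpEquiv.map_add }

/-- `fpRingEquiv = fpEquiv` on elements. -/
@[simp] theorem fpRingEquiv_apply (x : FP G) : fpRingEquiv x = fpEquiv x := rfl

/-- `fpRingEquiv⁻¹ = fpEquiv⁻¹` on elements. -/
@[simp] theorem fpRingEquiv_symm_apply (y : AddMonoidAlgebra ℚ G) :
    fpRingEquiv.symm y = fpEquiv.symm y := rfl

/-- `P̃(𝒞_G)` is a `ℚ`-algebra. -/
instance instAlgebra : Algebra ℚ (FP G) := Algebra.ofModule
  (fun r a b => fpEquiv.injective (by simp))
  (fun r a b => fpEquiv.injective (by simp))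

/-- `p_0 = 1`: the unit object has formal period `1`. -/
theorem gen_zero_eq_one : gen (0 : G) = 1 :=
  fpEquiv.injective (by rw [fpEquiv_gen, fpEquiv_one, AddMonoidAlgebra.one_def])

/-- `p_{g + g'} = p_g · p_{g'}` (`𝟙_{g+g'} ≅ 𝟙_g ⊗ 𝟙_{g'}`). -/
theorem gen_add (g g' : G) : gen (g + g') = gen g * gen g' :=
  fpEquiv.injective (by simp [AddMonoidAlgebra.single_mul_single])

/-- `p_{n • g} = p_g ^ n`. -/
theorem gen_nsmul (n : ℕ) (g : G) : gen (n • g) = gen g ^ n := by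
  induction n with
  | zero => rw [zero_smul, pow_zero, gen_zero_eq_one]
  | succ n ih => rw [succ_nsmul, gen_add, ih, pow_succ]

/-- THE PRODUCT IS THE TENSOR PRODUCT OF SYMBOLS:
`⟦(X, σ, ω)⟧ · ⟦(Y, τ, η)⟧ = ⟦(X ⊗ Y, σ ⊗ τ, ω ⊗ η)⟧`. -/
theorem cls_mul_cls (X Y : SoloInformedGrObj G) (σ ω : X.B → ℚ) (τ η : Y.B → ℚ) :
    cls X σ ω * cls Y τ η =
      cls (tensor X Y) (fun p => σ p.1 * τ p.2) (fun p => ω p.1 * η p.2) := by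
  apply fpEquiv.injective
  rw [fpEquiv_mul, fpEquiv_cls, fpEquiv_cls, fpEquiv_cls, Finset.sum_mul_sum,
    ← Finset.sum_product', Finset.univ_product_univ]
  refine Finset.sum_congr rfl fun p _ => ?_
  simp only [AddMonoidAlgebra.single_mul_single]
  congr 1
  all_goals first | rfl | ring

/-- The same for sigma-typed symbols. -/
theorem clsSym_mul_clsSym (s s' : Sym G) : clsSym s * clsSym s' = clsSym (s.tensor s') :=
  cls_mul_cls s.1 s'.1 s.2.1 s.2.2 s'.2.1 s'.2.2

/-- Two `ℚ`-linear maps out of `P̃(𝒞_G)` that agree on the classes `p_g` are equal. -/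
theorem linearMap_ext {N : Type*} [AddCommGroup N] [Module ℚ N] {f f' : FP G →ₗ[ℚ] N}
    (h : ∀ g : G, f (gen g) = f' (gen g)) : f = f' := by
  refine LinearMap.ext fun x => ?_
  rw [← fpEquiv.symm_apply_apply x]
  induction fpEquiv x using AddMonoidAlgebra.induction_linear with
  | zero => simp
  | add a b ha hb => simp [ha, hb]
  | single g r => rw [fpEquiv_symm_single, map_smul, map_smul, h]

/-! ### The evaluation map of [HW22, Def. 7.11] -/

/-- The character `g ↦ c^{w g}` of `G`. -/
def chiHom (w : G →+ ℤ) (c : ℂˣ) : Multiplicative G →* ℂ where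
  toFun g := (c : ℂ) ^ w (Multiplicative.toAdd g)
  map_one' := by simp
  map_mul' a b := by simp [zpow_add₀ c.ne_zero]

/-- Unfolding of `chiHom`. -/
@[simp] theorem chiHom_apply (w : G →+ ℤ) (c : ℂˣ) (g : Multiplicative G) :
    chiHom w c g = (c : ℂ) ^ w (Multiplicative.toAdd g) := rfl

/-- Evaluation on `ℚ[G]`: `[g] ↦ c^{w g}`. -/
def evAlg (w : G →+ ℤ) (c : ℂˣ) : AddMonoidAlgebra ℚ G →ₐ[ℚ] ℂ :=
  AddMonoidAlgebra.lift ℚ ℂ G (chiHom w c)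

/-- `evAlg (r[g]) = r c^{w g}`. -/
@[simp] theorem evAlg_single (w : G →+ ℤ) (c : ℂˣ) (g : G) (r : ℚ) :
    evAlg w c (AddMonoidAlgebra.single g r) = (r : ℂ) * (c : ℂ) ^ w g := by
  rw [evAlg, AddMonoidAlgebra.lift_single, chiHom_apply, toAdd_ofAdd, Algebra.smul_def]
  exact congrArg (· * _) (eq_ratCast _ r)

/-- The evaluation map `ev : P̃(𝒞_G) → ℂ` (a ring homomorphism) attached to the weight `w` and
the number `c` (the comparison of `V(X)` being `diag(c^{w ∘ deg})`). -/
def evRingHom (w : G →+ ℤ) (c : ℂˣ) : FP G →+* ℂ :=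
  (evAlg w c).toRingHom.comp (fpRingEquiv (G := G)).toRingHom

/-- `ev = evAlg ∘ fpEquiv`. -/
theorem evRingHom_apply (w : G →+ ℤ) (c : ℂˣ) (x : FP G) :
    evRingHom w c x = evAlg w c (fpEquiv x) := rfl

/-- `ev` IS the evaluation of Def. 7.11: `ev ⟦(X, σ, ω)⟧ = ω_ℂ(φ_X σ_ℂ) = ∑_b ω_b c^{w(deg b)} σ_b`. -/
theorem ev_cls (w : G →+ ℤ) (c : ℂˣ) (X : SoloInformedGrObj G) (σ ω : X.B → ℚ) :
    evRingHom w c (cls X σ ω) = ∑ b, (ω b : ℂ) * ((c : ℂ) ^ w (X.deg b) * (σ b : ℂ)) := by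
  rw [evRingHom_apply, fpEquiv_cls, map_sum]
  refine Finset.sum_congr rfl fun b _ => ?_
  rw [evAlg_single]
  push_cast
  ring

/-- `ev p_g = c^{w g}`. -/
@[simp] theorem ev_gen (w : G →+ ℤ) (c : ℂˣ) (g : G) :
    evRingHom w c (gen g) = (c : ℂ) ^ w g := by
  rw [evRingHom_apply, fpEquiv_gen, evAlg_single]; simp

/-- The Period Conjecture for `(𝒞_G, w, c)` [HW22, Def. 7.15] — injectivity of `ev` on the formal
period ring — is equivalent to injectivity of `ℚ[G] → ℂ`, `[g] ↦ c^{w g}`. -/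
theorem ev_injective_iff (w : G →+ ℤ) (c : ℂˣ) :
    Function.Injective (evRingHom (G := G) w c) ↔ Function.Injective (evAlg (G := G) w c) := by
  constructor
  · intro h x y e
    have := @h (fpEquiv.symm x) (fpEquiv.symm y)
      (by simpa [evRingHom_apply] using e)
    simpa using congrArg fpEquiv this
  · intro h x y e
    exact fpEquiv.injective (h (by simpa [evRingHom_apply] using e))

/-! ### Change of degrees: the functor induced by `h : G →+ G'` -/

variable {G' : Type} [AddCommMonoid G']

/-- On objects: same basis, degrees pushed along `h`. -/
@[reducible] def mapObj (h : G →+ G') (X : SoloInformedGrObj G) : SoloInformedGrObj G' where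
  B := X.B
  deg := fun b => h (X.deg b)

/-- On morphisms: the same matrix (still graded). -/
def mapHom (h : G →+ G') {X Y : SoloInformedGrObj G} (f : Hom X Y) :
    Hom (mapObj h X) (mapObj h Y) where
  mat := f.mat
  graded y x hne := f.graded y x fun e => hne (by simp [e])

/-- `h_*` does not change matrices. -/
@[simp] theorem mapHom_mat (h : G →+ G') {X Y : SoloInformedGrObj G} (f : Hom X Y) :
    (mapHom h f).mat = f.mat := rfl

/-- The functor `h_*` is faithful: a morphism is its matrix. -/
theorem mapHom_injective (h : G →+ G') (X Y : SoloInformedGrObj G) :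
    Function.Injective (mapHom h (X := X) (Y := Y)) := by
  intro f g e
  have he : f.mat = g.mat := by rw [← mapHom_mat h f, e, mapHom_mat]
  cases f; cases g
  cases he
  rfl

/-- `h_*` is a tensor functor: `h_* (X ⊗ Y) = h_* X ⊗ h_* Y` (on the nose). -/
theorem mapObj_tensor (h : G →+ G') (X Y : SoloInformedGrObj G) :
    mapObj h (tensor X Y) = tensor (mapObj h X) (mapObj h Y) := by
  simp only [mapObj, tensor, map_add]

/-- `h_*` is compatible with the fibre functors when the weights match: the comparison of
`h_* X` for `w'` is the comparison of `X` for `w' ∘ h`. -/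
theorem mapObj_comparison (h : G →+ G') (w' : G' →+ ℤ) (c : ℂˣ) (X : SoloInformedGrObj G)
    (b : X.B) : (c : ℂ) ^ w' ((mapObj h X).deg b) = (c : ℂ) ^ (w'.comp h) (X.deg b) := rfl

/-- The induced map of formal period rings (transport of `ℚ[h]`); it IS the map induced by the
functor on symbols by `fpMap_cls` below. -/
def fpMap (h : G →+ G') : FP G →+* FP G' where
  toFun x := fpEquiv.symm (AddMonoidAlgebra.mapDomain h (fpEquiv x))
  map_one' := fpEquiv.injective (by simp)
  map_mul' a b := fpEquiv.injective (by simp [AddMonoidAlgebra.mapDomain_mul])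
  map_zero' := fpEquiv.injective (by simp)
  map_add' a b := fpEquiv.injective (by simp [AddMonoidAlgebra.mapDomain_add])

/-- `fpEquiv ∘ fpMap h = ℚ[h] ∘ fpEquiv`. -/
theorem fpEquiv_fpMap (h : G →+ G') (x : FP G) :
    fpEquiv (fpMap h x) = AddMonoidAlgebra.mapDomain h (fpEquiv x) := by
  show fpEquiv (fpEquiv.symm (AddMonoidAlgebra.mapDomain h (fpEquiv x))) = _
  exact fpEquiv.apply_symm_apply _

/-- `fpMap h (p_g) = p_{h g}`. -/
@[simp] theorem fpMap_gen (h : G →+ G') (g : G) : fpMap h (gen g) = gen (h g) := by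
  apply fpEquiv.injective
  rw [fpEquiv_fpMap, fpEquiv_gen, fpEquiv_gen, AddMonoidAlgebra.mapDomain_single]

/-- `fpMap h` IS the map induced by the functor on symbols: `⟦(X, σ, ω)⟧ ↦ ⟦(h_* X, σ, ω)⟧`. -/
theorem fpMap_cls (h : G →+ G') (X : SoloInformedGrObj G) (σ ω : X.B → ℚ) :
    fpMap h (cls X σ ω) = cls (mapObj h X) σ ω := by
  rw [cls_eq_sum, cls_eq_sum, map_sum]
  refine Finset.sum_congr rfl fun b _ => ?_
  rw [map_rat_smul, fpMap_gen]

/-- Compatibility with evaluation: if `w = w' ∘ h` then `ev' ∘ fpMap h = ev`. -/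
theorem ev_fpMap (h : G →+ G') (w' : G' →+ ℤ) (c : ℂˣ) (x : FP G) :
    evRingHom w' c (fpMap h x) = evRingHom (w'.comp h) c x := by
  induction x using Submodule.Quotient.induction_on with
  | H v =>
    induction v using Finsupp.induction_linear with
    | zero => simp
    | add a b ha hb =>
      simp only [Submodule.Quotient.mk_add, map_add] at *
      rw [ha, hb]
    | single s r =>
      obtain ⟨X, σ, ω⟩ := s
      have hs : (Finsupp.single (⟨X, (σ, ω)⟩ : Sym G) r : Free G) = r • fsym X σ ω := by
        rw [fsym, mkSym, Finsupp.smul_single', mul_one]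
      rw [hs, Submodule.Quotient.mk_smul]
      change evRingHom w' c (fpMap h (r • cls X σ ω)) = evRingHom (w'.comp h) c (r • cls X σ ω)
      rw [map_rat_smul, map_rat_smul, map_rat_smul, fpMap_cls, ev_cls, ev_cls]
      rfl

/-- The kernel of `fpMap h` is everything when… no: `fpMap h` is injective as soon as `h` is
(graded pieces are not merged). -/
theorem fpMap_injective (h : G →+ G') (hh : Function.Injective h) :
    Function.Injective (fpMap h) := by
  intro x y e
  have e' := congrArg fpEquiv e
  rw [fpEquiv_fpMap, fpEquiv_fpMap] at e'
  exact fpEquiv.injective (AddMonoidAlgebra.mapDomain_injective hh e')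

end SoloInformedGrObj

end Summit.KontsevichZagierPeriods.KontsevichZagierPeriods.Theorems
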